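import Mathlib
import Literature.Combinatorics.Optimization.BipartiteRegularFactor

/-!
# `DivisionGap.PerMultiplesHard` (stmt-ValiantsHypothesis-5068), line `uncharged-face-walk`:
stub `stub_regularFactor` — the bipartite `f`-factor theorem

The line needs `f`-regular spanning subgraphs of bipartite host graphs `Y ⊆ Fin n × Fin n`
(rows × columns) under the cut condition `e_Y(A, B) ≥ f (#A + #B − n)` for all row sets `A`
and column sets `B` (Ore 1956; the bipartite case of the `f`-factor theorem).  This is the tree
theorem `Literature.Combinatorics.Optimization.exists_regular_subgraph_of_cut_condition`, proved
there from Hoffman's circulation theorem (integral form,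
`Literature.Combinatorics.Optimization.Hoffman1960_circulationTheorem_holds`) on the network
rows/columns/hub with cell arcs of capacity `1`, hub arcs with both bounds `f`; the stub is the
one-line wrapper with the registered signature.
-/

-- `Summit.ValiantsHypothesis.ValiantsHypothesis.…` is the tree's mandated layout (Sub = Summit).
set_option linter.dupNamespace false

namespace Summit.ValiantsHypothesis.ValiantsHypothesis.Theorems.DivisionGap.PerMultiplesHard.RegularFactor

/-- **stub_regularFactor — the bipartite `f`-factor theorem (Ore 1956).**  A bipartite graph
`Y ⊆ Fin n × Fin n` (rows × columns) with `f (#A + #B) ≤ f n + #{e ∈ Y : e.1 ∈ A, e.2 ∈ B}` for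
all row sets `A` and column sets `B` has an `f`-regular spanning subgraph `Y' ⊆ Y` (exactly `f`
cells in every row and every column).  Wrapper of
`Literature.Combinatorics.Optimization.exists_regular_subgraph_of_cut_condition` (from Hoffman's
circulation theorem, Bondy–Murty Thm 20.9). [cite: Ore1956, Thm (bipartite f-factors)] -/
theorem stub_regularFactor :
    ∀ (n f : ℕ) (Y : Finset (Fin n × Fin n)),
      (∀ A B : Finset (Fin n),
        f * (A.card + B.card) ≤ f * n + (Y.filter fun e => e.1 ∈ A ∧ e.2 ∈ B).card) →
      ∃ Y' : Finset (Fin n × Fin n), Y' ⊆ Y ∧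
        (∀ i : Fin n, (Finset.univ.filter fun j : Fin n => (i, j) ∈ Y').card = f) ∧
        (∀ j : Fin n, (Finset.univ.filter fun i : Fin n => (i, j) ∈ Y').card = f) :=
  Literature.Combinatorics.Optimization.exists_regular_subgraph_of_cut_condition

end Summit.ValiantsHypothesis.ValiantsHypothesis.Theorems.DivisionGap.PerMultiplesHard.RegularFactor
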